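import Summits.ValiantsHypothesis.ValiantsHypothesis.Theorems.LacunarySymmetroidMatrixDescartesDeepEndLawTwo
import Summits.ValiantsHypothesis.ValiantsHypothesis.Theorems.LacunarySymmetroidMatrixDescartesLiveIndefiniteEnds

/-!
# `MatrixDescartes` census — THE ISO-THREE LAW at `m = 2`: at a generic INDEFINITE end a further letter is worth THREE

HONEST FRAMING.  Cell `val-V1-extremal` (engine seat val-v1x-eng-6 g5, the `m = 2, 3` row lineage), helper file `--supports` the crux
`Theses.LacunarySymmetroid.MatrixDescartes` (stmt-ValiantsHypothesis-18050), OPEN and asserted nowhere here.  LOWER-bound / construction mathematics in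
census (CONJECTURE-A) currency; nothing about the crux (an upper bound at fat formats), `DoorA26` / `DoorA34`, or `VP ≠ VNP`.  No definitions, no `sorry`.

The composition of two kernel laws of this lineage:
* g4's DEEP END AT `m = 2` (`Census.DeepEnd.not_posRootLawAt_deepEnd_two_compression`: a core with an `N`-alternation certificate and a direction `w`
  whose compression `wᵀP(y)w` alternates `M` times beyond the certificate give `¬ PosRootLawAt 2 (K+1) (N+M+1)` — the end is worth `2 + M`), and
* g5's LIVE INDEFINITE END (`Census.LiveEnd.exists_rayleigh_alternation_top`: an isotropic vector of the top letter seen by the second letter makes some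
  compression alternate once beyond ANY threshold — `M ≥ 1` is always available),
gives **`not_posRootLawAt_isoThree`**: for a real symmetric `2 × 2` pencil on a strictly increasing support with `K + 2` letters and an `N`-alternation
certificate, if `w` is isotropic for the TOP letter (`wᵀ S_top w = 0`), anisotropic for the second letter (`wᵀ S_sec w ≠ 0`) and `wᵀ S_top v ≠ 0` for some
`v` — an OPEN DENSE condition inside «top letter indefinite and nonsingular» — then **`¬ PosRootLawAt 2 (K+3) (N+2)`**: one more letter buys THREE
alternations (graft law: two; at a definite end the flag mechanism yields exactly two, `…DeadDefiniteEnds`).  This is the census's «ISO +3» ray of the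
`m = 2` row (eng-5 / eng-11 anatomy, pub-symmetroid Table S chain rays) as a law for every support and every core, and the `M = 1` floor of the END-YIELD
table (seat reports HOME/eng-6/g4, g5).  [folklore] composition only.
-/

-- `Summit.ValiantsHypothesis.ValiantsHypothesis.…` repeats a component by the D-0017 layout
-- (single-conjunct summit), which the `dupNamespace` linter flags; the name is mandated.
set_option linter.dupNamespace false

namespace Summit.ValiantsHypothesis.ValiantsHypothesis.Theorems.LacunarySymmetroidMatrixDescartes.Census.DeepEnd

open Matrix Finset
open scoped BigOperators
open Summit.ValiantsHypothesis.ValiantsHypothesis.Theorems.MatrixDescartes.Negative (PosRootLawAt)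
open Summit.ValiantsHypothesis.ValiantsHypothesis.Theorems.LacunarySymmetroidMatrixDescartes.Census.LiveEnd
  (exists_rayleigh_alternation_top)

/-- **THE ISO-THREE LAW (`m = 2`).**  See the module docstring. [folklore] -/
theorem not_posRootLawAt_isoThree {K N : ℕ} (d : Fin (K + 2) → ℕ) (hd : StrictMono d)
    (S : Fin (K + 2) → Matrix (Fin 2) (Fin 2) ℝ) (hS : ∀ l, (S l).IsSymm)
    (τ : Fin (N + 1) → ℝ) (hτ : StrictMono τ) (hτpos : ∀ j, 0 < τ j)
    (hne : ∀ j, (∑ l, τ j ^ d l • S l).det ≠ 0)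
    (halt : ∀ j : Fin N, (∑ l, τ j.castSucc ^ d l • S l).det * (∑ l, τ j.succ ^ d l • S l).det < 0)
    (w v : Fin 2 → ℝ) (hw0 : w ⬝ᵥ (S (Fin.last (K + 1)) *ᵥ w) = 0)
    (hw1 : w ⬝ᵥ (S (Fin.last K).castSucc *ᵥ w) ≠ 0) (hwv : w ⬝ᵥ (S (Fin.last (K + 1)) *ᵥ v) ≠ 0) :
    ¬ PosRootLawAt 2 (K + 3) (N + 2) := by
  -- the top letter has the strictly largest exponent, the second letter the second largest
  have htop : ∀ k, k ≠ Fin.last (K + 1) → d k < d (Fin.last (K + 1)) := fun k hk =>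
    hd (lt_of_le_of_ne (Fin.le_last k) hk)
  have hsec : ∀ k, k ≠ Fin.last (K + 1) → k ≠ (Fin.last K).castSucc → d k < d (Fin.last K).castSucc := by
    intro k hk1 hk2
    apply hd
    rcases lt_or_ge k (Fin.last K).castSucc with h | h
    · exact h
    · exfalso
      have h1 : (k : ℕ) ≤ K + 1 := Nat.lt_succ_iff.mp k.isLt
      have h2 : ((Fin.last K).castSucc : Fin (K + 2)) ≤ k := h
      have h2' : K ≤ (k : ℕ) := by
        have := Fin.le_def.mp h2
        simpa using this
      have : (k : ℕ) ≠ K + 1 := fun h => hk1 (Fin.ext (by simp [h]))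
      have : (k : ℕ) ≠ K := fun h => hk2 (Fin.ext (by simp [h]))
      omega
  -- one alternation of a compression beyond `τ_last + 1`
  obtain ⟨u, x, y, hx, hxy, hprod⟩ :=
    exists_rayleigh_alternation_top d S hS (Fin.last (K + 1)) ((Fin.last K).castSucc) htop hsec w v hw0 hw1 hwv
      (τ (Fin.last N) + 1)
  -- package it as an `M = 1` compression certificate
  let σ : Fin 2 → ℝ := ![x, y]
  have hσ : StrictMono σ := by
    refine Fin.strictMono_iff_lt_succ.mpr fun i => ?_
    fin_cases i
    simpa [σ] using hxy
  have hsep : τ (Fin.last N) < σ 0 := by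
    show τ (Fin.last N) < x
    linarith
  have hune : ∀ j, u ⬝ᵥ ((∑ l, σ j ^ d l • S l) *ᵥ u) ≠ 0 := by
    intro j
    fin_cases j
    · show u ⬝ᵥ ((∑ l, x ^ d l • S l) *ᵥ u) ≠ 0
      intro h; rw [h, zero_mul] at hprod; exact lt_irrefl 0 hprod
    · show u ⬝ᵥ ((∑ l, y ^ d l • S l) *ᵥ u) ≠ 0
      intro h; rw [h, mul_zero] at hprod; exact lt_irrefl 0 hprod
  have hualt : ∀ j : Fin 1, (u ⬝ᵥ ((∑ l, σ j.castSucc ^ d l • S l) *ᵥ u)) *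
      (u ⬝ᵥ ((∑ l, σ j.succ ^ d l • S l) *ᵥ u)) < 0 := by
    intro j
    fin_cases j
    simpa [σ] using hprod
  have h := not_posRootLawAt_deepEnd_two_compression (N := N) (M := 1) d hd S hS τ hτ hτpos hne halt u σ hσ hsep hune hualt
  -- `K + 2 + 1 = K + 3`, `N + 1 + 1 = N + 2`
  simpa using h

end Summit.ValiantsHypothesis.ValiantsHypothesis.Theorems.LacunarySymmetroidMatrixDescartes.Census.DeepEnd
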